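import Mathlib.Probability.Moments.SubGaussian
import Literature.Probability.Percolation.SiteMonotonicity
import Literature.Probability.Percolation.CerfLem71Proofs
import HarnessLib

/-!
# Adaptive exploration of site configurations and Hoeffding's inequality

Topic `Literature/Probability/Percolation`. Sorry-free tools for Bernoulli site percolation
`sitePercolation V p` (`Percolation.lean`) formalising the *exploration* (growth-algorithm)
argument of Aizenman–Kesten–Newman (1987, Lemma 3.1 ff.) and Gandolfi–Grimmett–Russo (1988),
in the quantitative form used by R. Cerf, *A lower bound on the two-arms exponent for critical
percolation on the lattice*, Ann. Probab. 43 (2015), Prop. 4.1 (arXiv:1306.3105, §4, p. 7):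
when the sites of a finite region are revealed one at a time by an adaptive rule which never
looks twice at the same site, the revealed states behave like i.i.d. Bernoulli(`p`) variables,
so that the number of open sites among the first `k` revealed ones obeys Hoeffding's bound
`P(|#open − pk| ≥ s, k sites revealed) ≤ 2 exp(−2s²/k)`, uniformly in any information on the
sites outside the explored region.

## Contents

* `SiteDecisionTree V`: binary decision trees querying sites (`node v t₀ t₁`: query `v`, go
  to `t₁` if `v` is open, to `t₀` if it is closed); `length`, `openCount` (number of queries /
  of open answers along the run on a configuration), `Fresh Q` (no site of `Q` and no site
  twice on a branch), `Supported F` (all queries in `F`).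
* `SiteDecisionTree.leafSum`: the sum over the leaves of `μ(A ∩ [branch]) · g(S, m)`, `S` the
  accumulated `Σ (answerᵢ − p)`, `m` the number of queries; `leafSum_indicator` identifies it
  with `μ(A ∩ {g-event})`, and `leafSum_exp_le` is the supermartingale inequality
  `Σ_leaves μ(A ∩ [branch]) e^{tS − m t²/8} ≤ μ(A)` for `A` determined by the already-known
  sites (product structure + Hoeffding's lemma `p e^{t(1−p)} + (1−p) e^{−tp} ≤ e^{t²/8}`,
  `hoeffding_two_point`, from Mathlib's `ProbabilityTheory.hasSubgaussianMGF_of_mem_Icc`).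
* `sitePercolation_real_exploration_deviation_le`: **Hoeffding's inequality for adaptively
  revealed sites**, `μ(A ∩ {m = k, |#open − pk| ≥ s}) ≤ 2 e^{−2s²/k} μ(A)`.
* `clusterExplore`: Cerf's growth algorithm (p. 7) exploring `C̄(x) ∩ Λ` — the trace on `Λ` of
  the closure of the open cluster of `x` in the configuration restricted to `L ⊇ Λ` — given the
  configuration `η` on `L ∖ Λ`, as a decision tree; `clusterExplore_fresh`,
  `clusterExplore_supported` and the correctness statement `clusterExplore_spec`: on
  `{ω ∩ (L ∖ Λ) = η, x open}` the run queries exactly the sites of `C̄(x) ∩ Λ` and finds exactly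
  the sites of `C(x) ∩ Λ` open.

## References

* M. Aizenman, H. Kesten, C. M. Newman, Comm. Math. Phys. 111 (1987) 505–531, §3.
* A. Gandolfi, G. Grimmett, L. Russo, Comm. Math. Phys. 114 (1988) 549–552.
* R. Cerf, Ann. Probab. 43 (2015) 2458–2480, Prop. 4.1 (arXiv:1306.3105, p. 7).
* W. Hoeffding, J. Amer. Statist. Assoc. 58 (1963) 13–30, Thm 2 and Lemma 1 ((4.16)).
-/

noncomputable section

open MeasureTheory ProbabilityTheory

namespace Literature.Probability.Percolation

variable {V : Type*}

/-! ### Hoeffding's lemma for a Bernoulli variable -/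

/-- **Hoeffding's lemma for a Bernoulli(`p`) variable** (Hoeffding 1963, (4.16)):
`p e^{t(1−p)} + (1−p) e^{−tp} ≤ e^{t²/8}` for `p ∈ [0,1]`, `t ∈ ℝ`; obtained from Mathlib's
`hasSubgaussianMGF_of_mem_Icc` applied to the indicator of `{v open}` under `P_p`.
[cite: Hoeffding1963, Lemma 1 / (4.16)] -/
theorem hoeffding_two_point (p : unitInterval) (t : ℝ) :
    (p : ℝ) * Real.exp (t * (1 - p)) + (1 - p) * Real.exp (-(t * p)) ≤ Real.exp (t ^ 2 / 8) := by
  set μ := sitePercolation Unit p with hμ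
  set E : Set (SiteConfig Unit) := {ω | () ∈ ω} with hEdef
  have hE : MeasurableSet E := measurableSet_siteOpen ()
  set X : SiteConfig Unit → ℝ := E.indicator 1 with hX
  have hXm : Measurable X := measurable_one.indicator hE
  have hXb : ∀ᵐ ω ∂μ, X ω ∈ Set.Icc (0 : ℝ) 1 := by
    refine ae_of_all _ fun ω => ?_
    by_cases h : ω ∈ E
    · simp [hX, h]
    · simp [hX, h]
  have hEp : μ.real E = p := sitePercolation_real_mem p ()
  have hmean : μ[X] = (p : ℝ) := by rw [hX, integral_indicator_one hE, hEp]
  have hsg := hasSubgaussianMGF_of_mem_Icc hXm.aemeasurable hXb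
  have hmgf := hsg.mgf_le t
  have hcomp : mgf (fun ω => X ω - μ[X]) μ t =
      (p : ℝ) * Real.exp (t * (1 - p)) + (1 - p) * Real.exp (-(t * p)) := by
    rw [hmean]
    simp only [mgf]
    have hfun : (fun ω => Real.exp (t * (X ω - p))) = fun ω =>
        E.indicator (fun _ => Real.exp (t * (1 - p))) ω +
          Eᶜ.indicator (fun _ => Real.exp (-(t * p))) ω := by
      funext ω
      by_cases h : ω ∈ E
      · simp [hX, h]
      · simp [hX, h]
    have hi1 : Integrable (E.indicator fun _ => Real.exp (t * (1 - p))) μ :=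
      (integrable_const _).indicator hE
    have hi2 : Integrable (Eᶜ.indicator fun _ => Real.exp (-(t * p))) μ :=
      (integrable_const _).indicator hE.compl
    rw [hfun, integral_add hi1 hi2, integral_indicator_const _ hE,
      integral_indicator_const _ hE.compl, measureReal_compl hE, probReal_univ, hEp, smul_eq_mul,
      smul_eq_mul]
  rw [hcomp] at hmgf
  refine hmgf.trans (le_of_eq ?_)
  congr 1
  rw [sub_zero, nnnorm_one]
  push_cast
  ring

/-! ### Decision trees querying sites -/

/-- A binary **decision tree querying sites**: `leaf` (stop), or `node v t₀ t₁`: query the site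
`v` and continue with `t₁` if it is open, with `t₀` if it is closed. (The "growth algorithm
driven by a sequence of i.i.d. Bernoulli random variables" of Cerf 2015, p. 7, and of
Aizenman–Kesten–Newman 1987, §3, abstracted.) [cite: Cerf2015, §4] -/
inductive SiteDecisionTree (V : Type*) : Type _
  | leaf : SiteDecisionTree V
  | node : V → SiteDecisionTree V → SiteDecisionTree V → SiteDecisionTree V

namespace SiteDecisionTree

open Classical in
/-- Number of queries along the run of the tree on the configuration `ω`. [cite: Cerf2015, §4] -/
def length : SiteDecisionTree V → SiteConfig V → ℕ
  | leaf, _ => 0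
  | node v t₀ t₁, ω => (if v ∈ ω then t₁.length ω else t₀.length ω) + 1

open Classical in
/-- Number of queried sites found open along the run on `ω`. [cite: Cerf2015, §4] -/
def openCount : SiteDecisionTree V → SiteConfig V → ℕ
  | leaf, _ => 0
  | node v t₀ t₁, ω => if v ∈ ω then t₁.openCount ω + 1 else t₀.openCount ω

/-- The tree is **fresh** with respect to the set `Q` of already-known sites: it never queries
a site of `Q`, and never queries a site twice along a branch. [cite: Cerf2015, §4] -/
def Fresh : SiteDecisionTree V → Set V → Prop
  | leaf, _ => True
  | node v t₀ t₁, Q => v ∉ Q ∧ t₀.Fresh (insert v Q) ∧ t₁.Fresh (insert v Q)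

/-- All the sites queried by the tree (on any branch) lie in `F`. [cite: Cerf2015, §4] -/
def Supported : SiteDecisionTree V → Set V → Prop
  | leaf, _ => True
  | node v t₀ t₁, F => v ∈ F ∧ t₀.Supported F ∧ t₁.Supported F

/-- A leaf makes no query. [folklore] -/
@[simp] theorem length_leaf (ω : SiteConfig V) : (leaf : SiteDecisionTree V).length ω = 0 := rfl

/-- A leaf finds no open site. [folklore] -/
@[simp] theorem openCount_leaf (ω : SiteConfig V) :
    (leaf : SiteDecisionTree V).openCount ω = 0 := rfl

/-- Number of queries after an open answer. [folklore] -/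
theorem length_node_of_mem {v : V} {t₀ t₁ : SiteDecisionTree V} {ω : SiteConfig V}
    (h : v ∈ ω) : (node v t₀ t₁).length ω = t₁.length ω + 1 := by
  simp [length, h]

/-- Number of queries after a closed answer. [folklore] -/
theorem length_node_of_not_mem {v : V} {t₀ t₁ : SiteDecisionTree V} {ω : SiteConfig V}
    (h : v ∉ ω) : (node v t₀ t₁).length ω = t₀.length ω + 1 := by
  simp [length, h]

/-- Number of open answers after an open answer. [folklore] -/
theorem openCount_node_of_mem {v : V} {t₀ t₁ : SiteDecisionTree V} {ω : SiteConfig V}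
    (h : v ∈ ω) : (node v t₀ t₁).openCount ω = t₁.openCount ω + 1 := by
  simp [openCount, h]

/-- Number of open answers after a closed answer. [folklore] -/
theorem openCount_node_of_not_mem {v : V} {t₀ t₁ : SiteDecisionTree V} {ω : SiteConfig V}
    (h : v ∉ ω) : (node v t₀ t₁).openCount ω = t₀.openCount ω := by
  simp [openCount, h]

/-- A leaf is fresh. [folklore] -/
@[simp] theorem fresh_leaf (Q : Set V) : (leaf : SiteDecisionTree V).Fresh Q := trivial

/-- Freshness of a query node. [folklore] -/
theorem fresh_node_iff {v : V} {t₀ t₁ : SiteDecisionTree V} {Q : Set V} :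
    (node v t₀ t₁).Fresh Q ↔ v ∉ Q ∧ t₀.Fresh (insert v Q) ∧ t₁.Fresh (insert v Q) := Iff.rfl

/-- A leaf is supported anywhere. [folklore] -/
@[simp] theorem supported_leaf (F : Set V) : (leaf : SiteDecisionTree V).Supported F := trivial

/-- Support of a query node. [folklore] -/
theorem supported_node_iff {v : V} {t₀ t₁ : SiteDecisionTree V} {F : Set V} :
    (node v t₀ t₁).Supported F ↔ v ∈ F ∧ t₀.Supported F ∧ t₁.Supported F := Iff.rfl

/-- The statistics of the run are determined by the sites of any support. [folklore] -/
theorem eq_of_supported_of_inter_eq {T : SiteDecisionTree V} {F : Set V} (hT : T.Supported F)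
    {ω ω' : SiteConfig V} (h : ω ∩ F = ω' ∩ F) :
    T.length ω = T.length ω' ∧ T.openCount ω = T.openCount ω' := by
  induction T with
  | leaf => simp
  | node v t₀ t₁ ih₀ ih₁ =>
    obtain ⟨hv, h₀, h₁⟩ := hT
    have hvω : v ∈ ω ↔ v ∈ ω' := by
      have := Set.ext_iff.1 h v
      simp only [Set.mem_inter_iff] at this
      exact ⟨fun hω => (this.1 ⟨hω, hv⟩).1, fun hω' => (this.2 ⟨hω', hv⟩).1⟩
    by_cases hω : v ∈ ω
    · have hω' : v ∈ ω' := hvω.1 hω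
      rw [length_node_of_mem hω, length_node_of_mem hω', openCount_node_of_mem hω,
        openCount_node_of_mem hω', (ih₁ h₁).1, (ih₁ h₁).2]
      exact ⟨rfl, rfl⟩
    · have hω' : v ∉ ω' := fun h' => hω (hvω.2 h')
      rw [length_node_of_not_mem hω, length_node_of_not_mem hω', openCount_node_of_not_mem hω,
        openCount_node_of_not_mem hω', (ih₀ h₀).1, (ih₀ h₀).2]
      exact ⟨rfl, rfl⟩

/-- Events defined through the statistics of the run are determined by any support. [folklore] -/
theorem determinedBy_setOf {T : SiteDecisionTree V} {F : Set V} (hT : T.Supported F)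
    (R : ℕ → ℕ → Prop) : DeterminedBy {ω : SiteConfig V | R (T.length ω) (T.openCount ω)} F := by
  rw [determinedBy_iff]
  intro ω ω' h
  simp only [Set.mem_setOf_eq]
  rw [(eq_of_supported_of_inter_eq hT h).1, (eq_of_supported_of_inter_eq hT h).2]

/-! ### The sum over the leaves -/

/-- **Sum over the leaves.** `leafSum μ p g T A S m = Σ_{leaves ℓ of T} μ(A ∩ [the run ends at
ℓ]) · g(S + S_ℓ, m + m_ℓ)`, where along the branch to `ℓ`, `m_ℓ` sites are queried and
`S_ℓ = Σᵢ (𝟙[answerᵢ = open] − p)`; defined by structural recursion (a query splits `A`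
according to the state of the queried site). [folklore] -/
def leafSum (μ : Measure (SiteConfig V)) (p : ℝ) (g : ℝ → ℕ → ℝ) :
    SiteDecisionTree V → Set (SiteConfig V) → ℝ → ℕ → ℝ
  | leaf, A, S, m => μ.real A * g S m
  | node v t₀ t₁, A, S, m =>
      leafSum μ p g t₁ (A ∩ {ω | v ∈ ω}) (S + (1 - p)) (m + 1) +
        leafSum μ p g t₀ (A ∩ {ω | v ∉ ω}) (S - p) (m + 1)

variable {μ : Measure (SiteConfig V)} {p : ℝ}

/-- The leaf sum of a leaf. [folklore] -/
@[simp] theorem leafSum_leaf (g : ℝ → ℕ → ℝ) (A : Set (SiteConfig V)) (S : ℝ) (m : ℕ) :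
    leafSum μ p g leaf A S m = μ.real A * g S m := rfl

/-- The leaf sum of a query node (unfolding). [folklore] -/
theorem leafSum_node (g : ℝ → ℕ → ℝ) (v : V) (t₀ t₁ : SiteDecisionTree V)
    (A : Set (SiteConfig V)) (S : ℝ) (m : ℕ) :
    leafSum μ p g (node v t₀ t₁) A S m =
      leafSum μ p g t₁ (A ∩ {ω | v ∈ ω}) (S + (1 - p)) (m + 1) +
        leafSum μ p g t₀ (A ∩ {ω | v ∉ ω}) (S - p) (m + 1) := rfl

/-- Monotonicity of the leaf sum in the weight. [folklore] -/
theorem leafSum_mono {g g' : ℝ → ℕ → ℝ} (h : ∀ S m, g S m ≤ g' S m) (T : SiteDecisionTree V)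
    (A : Set (SiteConfig V)) (S : ℝ) (m : ℕ) :
    leafSum μ p g T A S m ≤ leafSum μ p g' T A S m := by
  induction T generalizing A S m with
  | leaf => exact mul_le_mul_of_nonneg_left (h S m) measureReal_nonneg
  | node v t₀ t₁ ih₀ ih₁ =>
    rw [leafSum_node, leafSum_node]
    exact add_le_add (ih₁ _ _ _) (ih₀ _ _ _)

/-- Linearity of the leaf sum in the weight (constant factor). [folklore] -/
theorem leafSum_const_mul (c : ℝ) (g : ℝ → ℕ → ℝ) (T : SiteDecisionTree V)
    (A : Set (SiteConfig V)) (S : ℝ) (m : ℕ) :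
    leafSum μ p (fun S m => c * g S m) T A S m = c * leafSum μ p g T A S m := by
  induction T generalizing A S m with
  | leaf => simp only [leafSum_leaf]; ring
  | node v t₀ t₁ ih₀ ih₁ =>
    rw [leafSum_node, leafSum_node, ih₁, ih₀]; ring

/-- **The leaf sum computes probabilities**: for the indicator weight of a predicate `R`,
`leafSum` is the measure of `A ∩ {R(S + Σ(answers − p), m + #queries)}`. [folklore] -/
theorem leafSum_indicator [IsFiniteMeasure μ] {T : SiteDecisionTree V} {F : Finset V}
    (hT : T.Supported ↑F) (R : ℝ → ℕ → Prop) [∀ S m, Decidable (R S m)]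
    {A : Set (SiteConfig V)} (hA : MeasurableSet A) (S : ℝ) (m : ℕ) :
    leafSum μ p (fun S m => if R S m then 1 else 0) T A S m =
      μ.real (A ∩ {ω | R (S + ((T.openCount ω : ℝ) - p * T.length ω)) (m + T.length ω)}) := by
  induction T generalizing A S m with
  | leaf =>
    simp only [leafSum_leaf, length_leaf, openCount_leaf, Nat.cast_zero, mul_zero, sub_zero,
      add_zero]
    by_cases h : R S m
    · simp [h]
    · simp [h]
  | node v t₀ t₁ ih₀ ih₁ =>
    obtain ⟨-, h₀, h₁⟩ := hT
    have hmv : MeasurableSet {ω : SiteConfig V | v ∈ ω} := measurableSet_siteOpen v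
    have hmv' : MeasurableSet {ω : SiteConfig V | v ∉ ω} := hmv.compl
    rw [leafSum_node, ih₁ h₁ (hA.inter hmv), ih₀ h₀ (hA.inter hmv')]
    set X : Set (SiteConfig V) := A ∩ {ω | R (S + (((node v t₀ t₁).openCount ω : ℝ) -
      p * (node v t₀ t₁).length ω)) (m + (node v t₀ t₁).length ω)} with hX
    rw [← measureReal_inter_add_sdiff (s := X) hmv (measure_ne_top _ _)]
    congr 1
    · congr 1
      ext ω
      simp only [hX, Set.mem_inter_iff, Set.mem_setOf_eq]
      constructor
      · rintro ⟨⟨hA', hvω⟩, hR⟩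
        refine ⟨⟨hA', ?_⟩, hvω⟩
        rw [length_node_of_mem hvω, openCount_node_of_mem hvω]
        have e1 : S + (((t₁.openCount ω + 1 : ℕ) : ℝ) - p * ((t₁.length ω + 1 : ℕ) : ℝ)) =
            S + (1 - p) + ((t₁.openCount ω : ℝ) - p * (t₁.length ω)) := by
          push_cast; ring
        have e2 : m + (t₁.length ω + 1) = m + 1 + t₁.length ω := by ring
        rw [e1, e2]; exact hR
      · rintro ⟨⟨hA', hR⟩, hvω⟩
        refine ⟨⟨hA', hvω⟩, ?_⟩
        rw [length_node_of_mem hvω, openCount_node_of_mem hvω] at hR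
        have e1 : S + (((t₁.openCount ω + 1 : ℕ) : ℝ) - p * ((t₁.length ω + 1 : ℕ) : ℝ)) =
            S + (1 - p) + ((t₁.openCount ω : ℝ) - p * (t₁.length ω)) := by
          push_cast; ring
        have e2 : m + (t₁.length ω + 1) = m + 1 + t₁.length ω := by ring
        rw [e1, e2] at hR; exact hR
    · congr 1
      ext ω
      simp only [hX, Set.mem_inter_iff, Set.mem_setOf_eq, Set.mem_sdiff]
      constructor
      · rintro ⟨⟨hA', hvω⟩, hR⟩
        refine ⟨⟨hA', ?_⟩, hvω⟩
        rw [length_node_of_not_mem hvω, openCount_node_of_not_mem hvω]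
        have e1 : S + ((t₀.openCount ω : ℝ) - p * ((t₀.length ω + 1 : ℕ) : ℝ)) =
            S - p + ((t₀.openCount ω : ℝ) - p * (t₀.length ω)) := by
          push_cast; ring
        have e2 : m + (t₀.length ω + 1) = m + 1 + t₀.length ω := by ring
        rw [e1, e2]; exact hR
      · rintro ⟨⟨hA', hR⟩, hvω⟩
        refine ⟨⟨hA', hvω⟩, ?_⟩
        rw [length_node_of_not_mem hvω, openCount_node_of_not_mem hvω] at hR
        have e1 : S + ((t₀.openCount ω : ℝ) - p * ((t₀.length ω + 1 : ℕ) : ℝ)) =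
            S - p + ((t₀.openCount ω : ℝ) - p * (t₀.length ω)) := by
          push_cast; ring
        have e2 : m + (t₀.length ω + 1) = m + 1 + t₀.length ω := by ring
        rw [e1, e2] at hR; exact hR

/-- **The supermartingale inequality behind Hoeffding's bound**: for a tree fresh with respect
to `Q` and an event `A` determined by the sites of `Q`,
`Σ_leaves μ(A ∩ [branch]) exp(t(S + S_ℓ) − (m + m_ℓ) t²/8) ≤ μ(A) exp(tS − m t²/8)`
under `P_p` (each query multiplies the weight by `p e^{t(1−p) − t²/8}` or
`(1−p) e^{−tp − t²/8}`, independently of the past, and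
`p e^{t(1−p)} + (1−p)e^{−tp} ≤ e^{t²/8}`). [cite: Hoeffding1963, Thm 2 (proof)] -/
theorem leafSum_exp_le (q : unitInterval) (t : ℝ) {T : SiteDecisionTree V} {Q : Finset V}
    (hT : T.Fresh ↑Q) {A : Set (SiteConfig V)} (hA : DeterminedBy A ↑Q) (S : ℝ) (m : ℕ) :
    leafSum (sitePercolation V q) q (fun S m => Real.exp (t * S - m * t ^ 2 / 8)) T A S m ≤
      (sitePercolation V q).real A * Real.exp (t * S - m * t ^ 2 / 8) := by
  induction T generalizing Q A S m with
  | leaf => simp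
  | node v t₀ t₁ ih₀ ih₁ =>
    classical
    obtain ⟨hv, h₀, h₁⟩ := hT
    set μ := sitePercolation V q with hμ
    have hvQ : v ∉ Q := fun h => hv (Finset.mem_coe.2 h)
    have hQ' : (↑(insert v Q) : Set V) = insert v (↑Q : Set V) := Finset.coe_insert v Q
    have hvdet : DeterminedBy {ω : SiteConfig V | v ∈ ω} (↑({v} : Finset V) : Set V) := by
      rw [Finset.coe_singleton]; exact determinedBy_mem v
    have hsub1 : (↑Q : Set V) ⊆ ↑(insert v Q) := by rw [hQ']; exact Set.subset_insert _ _
    have hsub2 : (↑({v} : Finset V) : Set V) ⊆ ↑(insert v Q) := by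
      rw [Finset.coe_singleton, hQ']; exact Set.singleton_subset_iff.2 (Set.mem_insert _ _)
    have hAo : DeterminedBy (A ∩ {ω | v ∈ ω}) ↑(insert v Q) :=
      (hA.mono hsub1).inter (hvdet.mono hsub2)
    have hAc : DeterminedBy (A ∩ {ω | v ∉ ω}) ↑(insert v Q) :=
      (hA.mono hsub1).inter (hvdet.compl.mono hsub2)
    have hf₁ : t₁.Fresh ↑(insert v Q) := by rw [hQ']; exact h₁
    have hf₀ : t₀.Fresh ↑(insert v Q) := by rw [hQ']; exact h₀
    have i₁ := ih₁ hf₁ hAo (S + (1 - q)) (m + 1)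
    have i₀ := ih₀ hf₀ hAc (S - q) (m + 1)
    have hind : μ.real (A ∩ {ω | v ∈ ω}) = μ.real A * q := by
      rw [hμ, sitePercolation_real_inter_of_disjoint q hA hvdet
        (Finset.disjoint_singleton_right.2 hvQ), sitePercolation_real_mem]
    have hindc : μ.real (A ∩ {ω | v ∉ ω}) = μ.real A * (1 - q) := by
      have h := measureReal_inter_add_sdiff (μ := μ) (s := A) (measurableSet_siteOpen v)
        (measure_ne_top _ _)
      rw [hind] at h
      have e : A \ {ω : SiteConfig V | v ∈ ω} = A ∩ {ω | v ∉ ω} := rfl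
      rw [e] at h
      linarith
    have hB : Real.exp (-t ^ 2 / 8) * ((q : ℝ) * Real.exp (t * (1 - q)) +
        (1 - q) * Real.exp (-(t * q))) ≤ 1 := by
      calc Real.exp (-t ^ 2 / 8) * ((q : ℝ) * Real.exp (t * (1 - q)) +
            (1 - q) * Real.exp (-(t * q)))
          ≤ Real.exp (-t ^ 2 / 8) * Real.exp (t ^ 2 / 8) :=
            mul_le_mul_of_nonneg_left (hoeffding_two_point q t) (Real.exp_nonneg _)
        _ = 1 := by rw [← Real.exp_add, show -t ^ 2 / 8 + t ^ 2 / 8 = 0 by ring, Real.exp_zero]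
    have e1 : Real.exp (t * (S + (1 - q)) - ((m + 1 : ℕ) : ℝ) * t ^ 2 / 8) =
        Real.exp (t * S - m * t ^ 2 / 8) * (Real.exp (-t ^ 2 / 8) * Real.exp (t * (1 - q))) := by
      rw [← Real.exp_add, ← Real.exp_add]; congr 1; push_cast; ring
    have e2 : Real.exp (t * (S - q) - ((m + 1 : ℕ) : ℝ) * t ^ 2 / 8) =
        Real.exp (t * S - m * t ^ 2 / 8) * (Real.exp (-t ^ 2 / 8) * Real.exp (-(t * q))) := by
      rw [← Real.exp_add, ← Real.exp_add]; congr 1; push_cast; ring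
    rw [leafSum_node]
    calc leafSum μ q (fun S m => Real.exp (t * S - m * t ^ 2 / 8)) t₁ (A ∩ {ω | v ∈ ω})
          (S + (1 - q)) (m + 1) +
        leafSum μ q (fun S m => Real.exp (t * S - m * t ^ 2 / 8)) t₀ (A ∩ {ω | v ∉ ω})
          (S - q) (m + 1)
        ≤ μ.real (A ∩ {ω | v ∈ ω}) * Real.exp (t * (S + (1 - q)) - ((m + 1 : ℕ) : ℝ) * t ^ 2 / 8) +
          μ.real (A ∩ {ω | v ∉ ω}) * Real.exp (t * (S - q) - ((m + 1 : ℕ) : ℝ) * t ^ 2 / 8) :=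
          add_le_add i₁ i₀
      _ = μ.real A * Real.exp (t * S - m * t ^ 2 / 8) * (Real.exp (-t ^ 2 / 8) *
          ((q : ℝ) * Real.exp (t * (1 - q)) + (1 - q) * Real.exp (-(t * q)))) := by
          rw [hind, hindc, e1, e2]; ring
      _ ≤ μ.real A * Real.exp (t * S - m * t ^ 2 / 8) * 1 :=
          mul_le_mul_of_nonneg_left hB (by positivity)
      _ = μ.real A * Real.exp (t * S - m * t ^ 2 / 8) := mul_one _

/-- **Hoeffding's inequality for adaptively revealed sites** (Aizenman–Kesten–Newman 1987 /
Gandolfi–Grimmett–Russo 1988 exploration; Cerf 2015, proof of Prop. 4.1, p. 7: "The status of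
these `k` sites is given by the first `k` variables of the sequence `(X_m)` … we have applied
Hoeffding's inequality"). For a decision tree fresh with respect to the finite set `Q` of
known sites and supported in a finite set, and any event `A` determined by the sites of `Q`:
`P_p(A ∩ {k queries, |#open answers − pk| ≥ s}) ≤ 2 exp(−2s²/k) P_p(A)`.
[cite: Cerf2015, Prop 4.1 (proof); Hoeffding1963, Thm 2] -/
theorem sitePercolation_real_exploration_deviation_le (q : unitInterval) {T : SiteDecisionTree V}
    {Q F : Finset V} (hT : T.Fresh ↑Q) (hTF : T.Supported ↑F) {A : Set (SiteConfig V)}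
    (hA : DeterminedBy A ↑Q) (k : ℕ) {s : ℝ} (hs : 0 ≤ s) :
    (sitePercolation V q).real
        (A ∩ {ω | T.length ω = k ∧ s ≤ |(T.openCount ω : ℝ) - q * k|}) ≤
      2 * Real.exp (-2 * s ^ 2 / k) * (sitePercolation V q).real A := by
  classical
  set μ := sitePercolation V q with hμ
  have hAm : MeasurableSet A := hA.measurableSet_of_finset
  -- one tail, for a sign `σ`
  have key : ∀ σ : ℝ, σ * σ = 1 →
      μ.real (A ∩ {ω | T.length ω = k ∧ s ≤ σ * ((T.openCount ω : ℝ) - q * k)}) ≤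
        Real.exp (-2 * s ^ 2 / k) * μ.real A := by
    intro σ hσ2
    set t : ℝ := σ * (4 * s / k) with ht
    have h1 : μ.real (A ∩ {ω | T.length ω = k ∧ s ≤ σ * ((T.openCount ω : ℝ) - q * k)}) =
        leafSum μ q (fun S' m' => if m' = k ∧ s ≤ σ * S' then 1 else 0) T A 0 0 := by
      rw [leafSum_indicator hTF (fun S' m' => m' = k ∧ s ≤ σ * S') hAm 0 0]
      congr 1
      ext ω
      simp only [Set.mem_inter_iff, Set.mem_setOf_eq, zero_add]
      constructor
      · rintro ⟨hA', hlen, hs'⟩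
        refine ⟨hA', hlen, ?_⟩
        rw [hlen]; exact hs'
      · rintro ⟨hA', hlen, hs'⟩
        refine ⟨hA', hlen, ?_⟩
        rw [hlen] at hs'; exact hs'
    have h2 : ∀ (S' : ℝ) (m' : ℕ), (if m' = k ∧ s ≤ σ * S' then (1 : ℝ) else 0) ≤
        Real.exp (-2 * s ^ 2 / k) * Real.exp (t * S' - m' * t ^ 2 / 8) := by
      intro S' m'
      split_ifs with h
      · obtain ⟨hm, hs'⟩ := h
        rw [hm, ← Real.exp_add]
        apply Real.one_le_exp
        rcases Nat.eq_zero_or_pos k with hk | hk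
        · rw [hk, ht, hk]
          simp
        · have hkr : (0 : ℝ) < k := by exact_mod_cast hk
          have htsq : t ^ 2 = (4 * s / k) ^ 2 := by
            rw [ht, mul_pow, pow_two σ, hσ2, one_mul]
          have ht2 : (k : ℝ) * t ^ 2 / 8 = 2 * s ^ 2 / k := by
            rw [htsq]; field_simp; ring
          have htS : 4 * s / k * s ≤ t * S' := by
            have : t * S' = 4 * s / k * (σ * S') := by rw [ht]; ring
            rw [this]
            exact mul_le_mul_of_nonneg_left hs' (by positivity)
          have e3 : 4 * s / k * s = 2 * s ^ 2 / k + 2 * s ^ 2 / k := by ring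
          have e4 : -2 * s ^ 2 / (k : ℝ) = -(2 * s ^ 2 / k) := by ring
          rw [e4]
          linarith
      · positivity
    calc μ.real (A ∩ {ω | T.length ω = k ∧ s ≤ σ * ((T.openCount ω : ℝ) - q * k)})
        = leafSum μ q (fun S' m' => if m' = k ∧ s ≤ σ * S' then 1 else 0) T A 0 0 := h1
      _ ≤ leafSum μ q (fun S' m' => Real.exp (-2 * s ^ 2 / k) *
            Real.exp (t * S' - m' * t ^ 2 / 8)) T A 0 0 := leafSum_mono h2 T A 0 0
      _ = Real.exp (-2 * s ^ 2 / k) *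
            leafSum μ q (fun S' m' => Real.exp (t * S' - m' * t ^ 2 / 8)) T A 0 0 :=
          leafSum_const_mul _ _ T A 0 0
      _ ≤ Real.exp (-2 * s ^ 2 / k) * (μ.real A * Real.exp (t * 0 - (0 : ℕ) * t ^ 2 / 8)) :=
          mul_le_mul_of_nonneg_left (leafSum_exp_le q t hT hA 0 0) (Real.exp_nonneg _)
      _ = Real.exp (-2 * s ^ 2 / k) * μ.real A := by simp
  -- the two tails
  have hsub : A ∩ {ω | T.length ω = k ∧ s ≤ |(T.openCount ω : ℝ) - q * k|} ⊆
      A ∩ {ω | T.length ω = k ∧ s ≤ 1 * ((T.openCount ω : ℝ) - q * k)} ∪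
        A ∩ {ω | T.length ω = k ∧ s ≤ (-1) * ((T.openCount ω : ℝ) - q * k)} := by
    rintro ω ⟨hA', hlen, hs'⟩
    rcases le_or_gt 0 ((T.openCount ω : ℝ) - q * k) with h | h
    · left
      refine ⟨hA', hlen, ?_⟩
      rw [abs_of_nonneg h] at hs'
      rw [one_mul]; exact hs'
    · right
      refine ⟨hA', hlen, ?_⟩
      rw [abs_of_neg h] at hs'
      rw [neg_one_mul]; exact hs'
  calc μ.real (A ∩ {ω | T.length ω = k ∧ s ≤ |(T.openCount ω : ℝ) - q * k|})
      ≤ μ.real (A ∩ {ω | T.length ω = k ∧ s ≤ 1 * ((T.openCount ω : ℝ) - q * k)} ∪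
          A ∩ {ω | T.length ω = k ∧ s ≤ (-1) * ((T.openCount ω : ℝ) - q * k)}) :=
        measureReal_mono hsub (measure_ne_top _ _)
    _ ≤ μ.real (A ∩ {ω | T.length ω = k ∧ s ≤ 1 * ((T.openCount ω : ℝ) - q * k)}) +
          μ.real (A ∩ {ω | T.length ω = k ∧ s ≤ (-1) * ((T.openCount ω : ℝ) - q * k)}) :=
        measureReal_union_le _ _
    _ ≤ Real.exp (-2 * s ^ 2 / k) * μ.real A + Real.exp (-2 * s ^ 2 / k) * μ.real A :=
        add_le_add (key 1 (by norm_num)) (key (-1) (by norm_num))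
    _ = 2 * Real.exp (-2 * s ^ 2 / k) * μ.real A := by ring

end SiteDecisionTree

end Literature.Probability.Percolation

/-! ### Cerf's growth algorithm as a decision tree -/

namespace Literature.Probability.Percolation

section CritPerc

open LatticeModels SiteDecisionTree

variable {V : Type*} [DecidableEq V]

section Explore

variable (G : SimpleGraph V) (L Λ η : Finset V) (x : V)

open Classical in
/-- **The active sites** of Cerf's growth algorithm (Cerf 2015, p. 7, the set `A_k`): given the
sites `Op ⊆ Λ` already found open and `Cl ⊆ Λ` already found closed, and the configuration
`η` outside `Λ`, the sites of `Λ` not yet explored which are known to lie in `C̄(x)`: `x`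
itself, and the neighbours of the part `C_L^{Op ∪ η}(x)` of the cluster of `x` already
discovered (Cerf's `V_k`: "neighbours of `x_k` or connected to `x_k` by an open path in
`Λ(n+ℓ) ∖ Λ(n)`"). [cite: Cerf2015, §4 (p. 7)] -/
def exploreActive (Op Cl : Finset V) : Finset V :=
  (Λ \ (Op ∪ Cl)).filter fun y => y = x ∨ ∃ z ∈ siteClusterIn G ↑L (↑Op ∪ ↑η) x, G.Adj z y

open Classical in
/-- **Cerf's growth algorithm** (Cerf 2015, proof of Prop. 4.1, p. 7) as a decision tree: while
some site is active, query one (`Exists.choose`); a closed answer moves it to `Cl`, an open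
answer to `Op`; `fuel` bounds the number of queries (`|Λ|` suffices, `clusterExplore_spec`).
[cite: Cerf2015, §4 (p. 7)] -/
def clusterExplore : ℕ → Finset V → Finset V → SiteDecisionTree V
  | 0, _, _ => leaf
  | fuel + 1, Op, Cl =>
      if h : (exploreActive G L Λ η x Op Cl).Nonempty then
        node h.choose (clusterExplore fuel Op (insert h.choose Cl))
          (clusterExplore fuel (insert h.choose Op) Cl)
      else leaf

variable {G L Λ η x}

open Classical in
/-- Membership in the active set. [cite: Cerf2015, §4 (p. 7)] -/
theorem mem_exploreActive_iff {Op Cl : Finset V} {y : V} :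
    y ∈ exploreActive G L Λ η x Op Cl ↔ y ∈ Λ ∧ y ∉ Op ∪ Cl ∧
      (y = x ∨ ∃ z ∈ siteClusterIn G ↑L (↑Op ∪ ↑η) x, G.Adj z y) := by
  simp only [exploreActive, Finset.mem_filter, Finset.mem_sdiff, and_assoc]

open Classical in
/-- One step of the growth algorithm (unfolding). [cite: Cerf2015, §4 (p. 7)] -/
theorem clusterExplore_succ (fuel : ℕ) (Op Cl : Finset V) :
    clusterExplore G L Λ η x (fuel + 1) Op Cl =
      if h : (exploreActive G L Λ η x Op Cl).Nonempty then
        node h.choose (clusterExplore G L Λ η x fuel Op (insert h.choose Cl))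
          (clusterExplore G L Λ η x fuel (insert h.choose Op) Cl)
      else leaf := rfl

/-- The growth algorithm only queries sites of `Λ`. [cite: Cerf2015, §4 (p. 7)] -/
theorem clusterExplore_supported (fuel : ℕ) (Op Cl : Finset V) :
    (clusterExplore G L Λ η x fuel Op Cl).Supported ↑Λ := by
  classical
  induction fuel generalizing Op Cl with
  | zero => trivial
  | succ fuel ih =>
    rw [clusterExplore_succ]
    split_ifs with h
    · exact ⟨Finset.mem_coe.2 (mem_exploreActive_iff.1 h.choose_spec).1, ih _ _, ih _ _⟩
    · trivial

/-- The growth algorithm is fresh with respect to any set of known sites whose trace on `Λ` has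
already been explored: it "never explores a site twice" (Cerf 2015, p. 7: "The site `x_k` has
not been explored previously"). [cite: Cerf2015, §4 (p. 7)] -/
theorem clusterExplore_fresh (fuel : ℕ) (Op Cl : Finset V) {Q : Set V}
    (hQ : Q ∩ ↑Λ ⊆ ↑Op ∪ ↑Cl) : (clusterExplore G L Λ η x fuel Op Cl).Fresh Q := by
  classical
  induction fuel generalizing Op Cl Q with
  | zero => trivial
  | succ fuel ih =>
    rw [clusterExplore_succ]
    split_ifs with h
    · obtain ⟨hyΛ, hyOC, -⟩ := mem_exploreActive_iff.1 h.choose_spec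
      refine ⟨fun hyQ => hyOC ?_, ih _ _ ?_, ih _ _ ?_⟩
      · have := hQ ⟨hyQ, Finset.mem_coe.2 hyΛ⟩
        simpa [Finset.mem_union] using this
      · rintro v ⟨hv | hv, hvΛ⟩
        · subst hv; simp
        · have := hQ ⟨hv, hvΛ⟩
          simp only [Set.mem_union, Finset.mem_coe] at this
          simp only [Set.mem_union, Finset.mem_coe, Finset.mem_insert]
          tauto
      · rintro v ⟨hv | hv, hvΛ⟩
        · subst hv; simp
        · have := hQ ⟨hv, hvΛ⟩
          simp only [Set.mem_union, Finset.mem_coe] at this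
          simp only [Set.mem_union, Finset.mem_coe, Finset.mem_insert]
          tauto
    · trivial

open Classical in
/-- **Correctness of the growth algorithm** (Cerf 2015, p. 7: "If `A_k = ∅`, the algorithm
terminates and `C̄(x) ∩ Λ(n) = O_k ∪ C_k` … `|C(x) ∩ Λ(n)| = X_1 + ⋯ + X_k`,
`|∂ᵒᵘᵗC(x) ∩ Λ(n)| = k − (X_1 + ⋯ + X_k)`"). Let `Λ ⊆ L`, `η ⊆ L ∖ Λ`, and let `ω` agree with
`η` on `L ∖ Λ` and have `x` open; write `C = C_L^ω(x)`. If the current state `(Op, Cl)`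
satisfies `Op ⊆ C ∩ Λ`, `Cl ⊆ (C̄ ∩ Λ)` closed, and `fuel ≥ |Λ ∖ (Op ∪ Cl)|`, then the run of
`clusterExplore fuel Op Cl` on `ω` makes `|C̄ ∩ Λ| − |Op ∪ Cl|` queries, of which
`|C ∩ Λ| − |Op|` are answered "open". [cite: Cerf2015, §4 (p. 7)] -/
theorem clusterExplore_spec (hΛL : Λ ⊆ L) (hη : η ⊆ L \ Λ) {ω : SiteConfig V}
    (hagree : ∀ v ∈ L, v ∉ Λ → (v ∈ ω ↔ v ∈ η)) (hx : x ∈ ω) (fuel : ℕ) (Op Cl : Finset V)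
    (hOp : ∀ y ∈ Op, y ∈ Λ ∧ y ∈ siteClusterIn G ↑L ω x)
    (hCl : ∀ y ∈ Cl, y ∈ Λ ∧ y ∉ ω ∧ ∃ z ∈ siteClusterIn G ↑L ω x, G.Adj z y)
    (hfuel : (Λ \ (Op ∪ Cl)).card ≤ fuel) :
    (clusterExplore G L Λ η x fuel Op Cl).length ω + (Op ∪ Cl).card =
        (Λ.filter fun y => y ∈ siteClusterIn G ↑L ω x ∨
          ∃ z ∈ siteClusterIn G ↑L ω x, G.Adj z y).card ∧
      (clusterExplore G L Λ η x fuel Op Cl).openCount ω + Op.card =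
        (Λ.filter fun y => y ∈ siteClusterIn G ↑L ω x).card := by
  set C : Set V := siteClusterIn G ↑L ω x with hC
  set Kfin : Finset V := Λ.filter (fun y => y ∈ C ∨ ∃ z ∈ C, G.Adj z y) with hK
  set Ofin : Finset V := Λ.filter (fun y => y ∈ C) with hO
  have hΛL' : ∀ {y}, y ∈ Λ → y ∈ (↑L : Set V) := fun hy => Finset.mem_coe.2 (hΛL hy)
  have hηω : ∀ v ∈ η, v ∈ ω := by
    intro v hv
    have hv' := Finset.mem_sdiff.1 (hη hv)
    exact (hagree v hv'.1 hv'.2).2 hv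
  -- (a) the discovered part of the cluster lies in the cluster
  have hDC : ∀ Op : Finset V, (∀ y ∈ Op, y ∈ Λ ∧ y ∈ C) →
      siteClusterIn G ↑L (↑Op ∪ ↑η) x ⊆ C := by
    intro Op hOp
    refine siteClusterIn_mono G ↑L ?_ x
    rintro v (hv | hv)
    · exact (mem_open_of_mem_siteClusterIn (hOp v hv).2).1
    · exact hηω v hv
  -- (b) active sites belong to `C̄ ∩ Λ`, with the right status
  have hact : ∀ Op Cl : Finset V, (∀ y ∈ Op, y ∈ Λ ∧ y ∈ C) → ∀ y ∈ exploreActive G L Λ η x Op Cl,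
      y ∈ Λ ∧ y ∉ Op ∪ Cl ∧ (y ∈ ω → y ∈ C) ∧ (y ∉ ω → ∃ z ∈ C, G.Adj z y) := by
    intro Op Cl hOp y hy
    obtain ⟨hyΛ, hyOC, hyx⟩ := mem_exploreActive_iff.1 hy
    refine ⟨hyΛ, hyOC, fun hyω => ?_, fun hyω => ?_⟩
    · rcases hyx with rfl | ⟨z, hz, hzy⟩
      · exact (mem_siteClusterIn_self_iff G ↑L ω y).2 ⟨hyω, hΛL' hyΛ⟩
      · exact mem_siteClusterIn_of_adj (hDC Op hOp hz) hzy hyω (hΛL' hyΛ)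
    · rcases hyx with rfl | ⟨z, hz, hzy⟩
      · exact absurd hx hyω
      · exact ⟨z, hDC Op hOp hz, hzy⟩
  -- (c) the final count
  have hfinal : ∀ Op Cl : Finset V, (∀ y ∈ Op, y ∈ Λ ∧ y ∈ C) →
      (∀ y ∈ Cl, y ∈ Λ ∧ y ∉ ω ∧ ∃ z ∈ C, G.Adj z y) → Kfin ⊆ Op ∪ Cl →
      (Op ∪ Cl).card = Kfin.card ∧ Op.card = Ofin.card := by
    intro Op Cl hOp hCl hKsub
    constructor
    · congr 1
      refine Finset.Subset.antisymm ?_ hKsub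
      intro y hy
      rw [hK, Finset.mem_filter]
      rcases Finset.mem_union.1 hy with hy | hy
      · exact ⟨(hOp y hy).1, Or.inl (hOp y hy).2⟩
      · exact ⟨(hCl y hy).1, Or.inr (hCl y hy).2.2⟩
    · congr 1
      refine Finset.Subset.antisymm ?_ ?_
      · intro y hy
        rw [hO, Finset.mem_filter]
        exact hOp y hy
      · intro y hy
        rw [hO, Finset.mem_filter] at hy
        have hyK : y ∈ Kfin := by rw [hK, Finset.mem_filter]; exact ⟨hy.1, Or.inl hy.2⟩
        rcases Finset.mem_union.1 (hKsub hyK) with h | h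
        · exact h
        · exact absurd (mem_open_of_mem_siteClusterIn hy.2).1 (hCl y h).2.1
  induction fuel generalizing Op Cl with
  | zero =>
    have hsub : Λ ⊆ Op ∪ Cl := by
      rw [← Finset.sdiff_eq_empty_iff_subset, ← Finset.card_eq_zero]
      exact Nat.le_zero.1 hfuel
    have hKsub : Kfin ⊆ Op ∪ Cl := fun y hy => hsub (Finset.mem_filter.1 hy).1
    obtain ⟨h1, h2⟩ := hfinal Op Cl hOp hCl hKsub
    exact ⟨by simpa [clusterExplore] using h1, by simpa [clusterExplore] using h2⟩
  | succ fuel ih =>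
    rw [clusterExplore_succ]
    split_ifs with h
    · -- a site is queried
      obtain ⟨hyΛ, hyOC, hyo, hyc⟩ := hact Op Cl hOp _ h.choose_spec
      have hlt : (Λ \ (insert h.choose (Op ∪ Cl))).card < (Λ \ (Op ∪ Cl)).card := by
        refine Finset.card_lt_card ((Finset.ssubset_iff_of_subset ?_).2 ⟨h.choose, ?_, ?_⟩)
        · exact Finset.sdiff_subset_sdiff subset_rfl (Finset.subset_insert _ _)
        · exact Finset.mem_sdiff.2 ⟨hyΛ, hyOC⟩
        · simp
      by_cases hyω : h.choose ∈ ω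
      · rw [length_node_of_mem hyω, openCount_node_of_mem hyω]
        have hOp' : ∀ y ∈ insert h.choose Op, y ∈ Λ ∧ y ∈ C := by
          intro y hy
          rcases Finset.mem_insert.1 hy with rfl | hy
          · exact ⟨hyΛ, hyo hyω⟩
          · exact hOp y hy
        have hfuel' : (Λ \ (insert h.choose Op ∪ Cl)).card ≤ fuel := by
          rw [Finset.insert_union]; omega
        obtain ⟨i1, i2⟩ := ih (insert h.choose Op) Cl (hOp := hOp') (hCl := hCl) (hfuel := hfuel')
        rw [Finset.insert_union, Finset.card_insert_of_notMem hyOC] at i1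
        rw [Finset.card_insert_of_notMem (fun h' => hyOC (Finset.mem_union_left _ h'))] at i2
        constructor <;> omega
      · rw [length_node_of_not_mem hyω, openCount_node_of_not_mem hyω]
        have hCl' : ∀ y ∈ insert h.choose Cl, y ∈ Λ ∧ y ∉ ω ∧ ∃ z ∈ C, G.Adj z y := by
          intro y hy
          rcases Finset.mem_insert.1 hy with rfl | hy
          · exact ⟨hyΛ, hyω, hyc hyω⟩
          · exact hCl y hy
        have hfuel' : (Λ \ (Op ∪ insert h.choose Cl)).card ≤ fuel := by
          rw [Finset.union_insert]; omega
        obtain ⟨i1, i2⟩ := ih Op (insert h.choose Cl) (hOp := hOp) (hCl := hCl') (hfuel := hfuel')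
        rw [Finset.union_insert, Finset.card_insert_of_notMem hyOC] at i1
        constructor <;> omega
    · -- no active site: the exploration is complete
      have hempty : ∀ y, y ∉ exploreActive G L Λ η x Op Cl := fun y hy => h ⟨y, hy⟩
      have hxL : ∀ {w}, w ∈ C → x ∈ (↑L : Set V) := fun hw =>
        (mem_open_of_mem_siteClusterIn (root_mem_siteClusterIn hw)).2
      -- the whole cluster has been discovered
      have hCD : ∀ w, w ∈ C → w ∈ siteClusterIn G ↑L (↑Op ∪ ↑η) x := by
        intro w hw
        have hxD : x ∈ siteClusterIn G ↑L (↑Op ∪ ↑η) x := by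
          refine (mem_siteClusterIn_self_iff G ↑L _ x).2 ⟨?_, hxL hw⟩
          by_cases hxΛ : x ∈ Λ
          · have hxOC : x ∈ Op ∪ Cl := by
              by_contra hn
              exact hempty x (mem_exploreActive_iff.2 ⟨hxΛ, hn, Or.inl rfl⟩)
            rcases Finset.mem_union.1 hxOC with h' | h'
            · exact Or.inl h'
            · exact absurd hx (hCl x h').2.1
          · exact Or.inr ((hagree x (hxL hw) hxΛ).1 hx)
        refine mem_of_siteConnIn_of_forall_adj (T := siteClusterIn G ↑L (↑Op ∪ ↑η) x)
          (fun u hu v huv hvω hvL => ?_) hxD hw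
        have hvOη : v ∈ (↑Op ∪ ↑η : Set V) := by
          by_cases hvΛ : v ∈ Λ
          · have hvCl : v ∉ Cl := fun h' => (hCl v h').2.1 hvω
            have hvOp : v ∈ Op := by
              by_contra hn
              refine hempty v (mem_exploreActive_iff.2 ⟨hvΛ, ?_, Or.inr ⟨u, hu, huv⟩⟩)
              rw [Finset.mem_union]; tauto
            exact Or.inl hvOp
          · exact Or.inr ((hagree v hvL hvΛ).1 hvω)
        exact mem_siteClusterIn_of_adj hu huv hvOη hvL
      have hKsub : Kfin ⊆ Op ∪ Cl := by
        intro y hy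
        obtain ⟨hyΛ, hyC | ⟨z, hz, hzy⟩⟩ := Finset.mem_filter.1 hy
        · rcases (mem_open_of_mem_siteClusterIn (hCD y hyC)).1 with h' | h'
          · exact Finset.mem_union_left _ h'
          · exact absurd hyΛ (Finset.mem_sdiff.1 (hη h')).2
        · by_contra hn
          exact hempty y (mem_exploreActive_iff.2 ⟨hyΛ, hn, Or.inr ⟨z, hCD z hz, hzy⟩⟩)
      obtain ⟨h1, h2⟩ := hfinal Op Cl hOp hCl hKsub
      exact ⟨by simpa using h1, by simpa using h2⟩

end Explore

end CritPerc

end Literature.Probability.Percolation
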